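import Literature.NumberTheory.Rogawski1990.ArchCentralLimitCornerJets                 -- ★ p843416∕p843539 (this lineage): `of_cornerRegularity`; brings the (A6) row ★ p843483 and ★ p843009
import Literature.NumberTheory.Rogawski1990.ArchCentralLimitFunctionalNoncompactWall     -- ★ p843006∕p843019 (A-p18): (h4) `lambda8Angle_zero_eq_of_wall02_oddJets_of_isOpen`
import Literature.NumberTheory.Rogawski1990.ArchCentralLimitNoncompactWallFirstJetCM    -- ★ p843187 (A-p18): (J3-odd)₁ CM `deriv_cornerExtensions_eq_of_wall02`; brings ★ p843058 chamber geometry of the normal line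
import Literature.NumberTheory.Rogawski1990.ArchCentralLimitNoncompactWallThirdJet      -- ★ p843408 (A-p18): (J3-odd)₃ decoupling `iteratedDeriv_three_cornerExtensions_eq_of_wall02_cubeLimit`
import Literature.NumberTheory.Automorphic.ArchLocalRegularOrbitClosed                 -- ★ `locallyCompactSpace_archLocal`, `secondCountableTopology_archLocal`
import HarnessLib

/-!
# N1 ASSEMBLY-READINESS: the (L_{U(2,1)}) letter `ArchCentralLimitFormulaRankTwo` from {(A6) corner regularity, the D-CHAMBER WALL VALUE, the (J3-odd)₃ cube limits} — CM frames whose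
# noncompact pair contains `{0,2}` (Rogawski 1990 §8.4 pp. 126–127; Harish-Chandra [H₂] L. 17.5; Varadarajan 1989 §6.4)

Topic `NumberTheory/Rogawski1990`; namespace `Literature.NumberTheory.Rogawski1990`.  THEOREMS ONLY (no `def`, no instance, no notation, no axiom, no named fact, no `sorry`).
Cell `pub/hodgecm-mathlib`, ENGINE T1 (crux H413 = `stmt-HodgeConjecture-24833`); ROAD A toward N1 = the registered stub `stub_L21 : ∀ L α w, ArchCentralLimitFormulaRankTwo L α w`
(closer ED. 25∕26) ∕ `stub_ArchCentralLimitU21` («SdArch» ED. 3); ROAD A owner F0P3a-p05 (g14) WORD R-14.3 (d) «ASSEMBLY-READINESS» → F0P3a-p02 (g13) (census 2026-09-01T11:5xZ, FILE B).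

THE THEOREM **`ArchCentralLimitFormulaRankTwo.of_cornerRegularity_of_wallValues`** (CM ground field `L`, frame with `re σ_wα₀ · re σ_wα₂ < 0`).  INPUTS, each a hypothesis BY NAME∕BY SHAPE:
* `hreg : ArchCentralLimitCornerRegularity L α w` — the (A6) print row ★ p843483 (Harish-Chandra's corner regularity: a `C³` corner extension of `F_Θ∘chart|_{C_σ}` on every chamber);
* `hD` — THE D-CHAMBER VALUE: the `hval` binder of ★ `of_cornerRegularity` VERBATIM, restricted to the four chambers ADJACENT TO THE COMPACT WALL `θ₀ = θ₁` (`σ 0 = 2 ∨ σ 2 = 2`, i.e. `θ₂`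
  extremal): one `c > 0` per `ν` with `Λ₈^∠[H](0) = −(c·i)·Θ(ζ•1)` for EVERY `C³` corner extension `H` on those chambers — the export of ROAD A's (A3)∕(A4) wall computation (F0P3a-p06 W6 over ★
  `ArchCentralLimitCompactWallOrbital` ED. 2, `c = 2π²·c_μ·(bridge)`);
* `hS` — (J3-odd)₃ in the print shape of ★ p843408's `hJ3`, pointwise: at every SEMIREGULAR point `ζe^{itA′}` of the noncompact wall `θ₀ = θ₂` (`cos 3t ≠ 1`) the third `s`-derivative of
  `s ↦ F_Θ(ζe^{i(tA′+sN′)})` (`A′ = (1,−2,1)`, `N′ = (1,0,−1)`) has ONE two-sided limit (Harish-Chandra: odd normal derivatives of `F_Θ` are continuous across a noncompact wall; A-p18's road Z, Z5).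
OUTPUT: `ArchCentralLimitFormulaRankTwo L α w`.  PROOF (★ `of_cornerRegularity hreg hval`): on the four compact-adjacent chambers `hval` IS `hD`; on the two doubly-noncompact chambers
`S⁻ = {θ₁<θ₂<θ₀}` ∕ `S⁺ = {θ₀<θ₂<θ₁}` (`σ 1 = 2`) the corner value of the given extension `H` equals that of an (A6)-extension `H′` of the compact-adjacent chamber across the half-wall
`t ∈ (0,δ)` (`D⁺ ∋ {θ₁<θ₀<θ₂}`) ∕ `t ∈ (−δ,0)` (`D⁻ ∋ {θ₂<θ₀<θ₁}`) by ★ (h4) `lambda8Angle_zero_eq_of_wall02_oddJets_of_isOpen` on `U ∩ U′`, whose premises are (h1) ★ (J3-odd)₁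
`deriv_cornerExtensions_eq_of_wall02` (CM: the (J-nc) limit formula ★ `archLimitFormulaNoncompactWall_holds`) and (h3) ★ `iteratedDeriv_three_cornerExtensions_eq_of_wall02_cubeLimit` fed by `hS`;
the side agreements come from ★ `wall02_line_mem_chamber_{pos,neg}_{pos,neg}`; then `hD` evaluates `H′`.  No `W_K` transport and no inversion symmetry are needed in this cut (`hD` covers all
four compact-adjacent chambers, `hS` both half-walls).
END STATE OF N1 (with ★ FILE A `archCentralLimitFormulaRankTwo_of_perm` and ★ `archCentralLimitFormulaRankTwo_of_cm_signs`): `stub_L21` closes by `exact` modulo {(A6) row, W6 ⇒ `hD`, Z5 ⇒ `hS`}.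
HONEST LABEL: HC_CM is proved only modulo the printed citations until rung 0 closes; this file is a sorry-free COMPOSITION and pays nothing by itself.

## References
* [Rogawski1990] J. D. Rogawski, *Automorphic Representations of Unitary Groups in Three Variables*, Ann. of Math. Stud. 123 (1990), §8.4 pp. 126–127, §8.2 p. 119.
* [Varadarajan1989] V. S. Varadarajan, *An Introduction to Harmonic Analysis on Semisimple Lie Groups* (1989), §6.4 Thm 17, Thm 22, Thm 24.
* [HarishChandra1975HARRG1] Harish-Chandra, *Harmonic analysis on real reductive groups I*, J. Funct. Anal. 19 (1975), §17 Lemma 17.5.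
-/

set_option autoImplicit false

noncomputable section

open Filter Topology Set MeasureTheory Measure NumberField NumberField.InfinitePlace
open Literature.NumberTheory.Automorphic Literature.NumberTheory.Automorphic.UnitaryGroup Literature.Analysis.Calculus
open scoped Matrix MatrixGroups Matrix.Norms.Operator

namespace Literature.NumberTheory.Rogawski1990

/-! ## §1 Small combinatorics and wall-parameter facts -/

section Prelim

/-- The six chambers: `θ₂` is extremal (`σ 0 = 2 ∨ σ 2 = 2`: the four compact-adjacent chambers) or in the middle (`σ 1 = 2`: the chambers `S⁻ = [1,2,0]`, `S⁺ = [0,2,1]`).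
[cite: Rogawski1990, §8.4 p. 126] -/
theorem perm_fin_three_cases (σ : Equiv.Perm (Fin 3)) :
    σ 0 = 2 ∨ σ 2 = 2 ∨ (σ 0 = 1 ∧ σ 1 = 2 ∧ σ 2 = 0) ∨ (σ 0 = 0 ∧ σ 1 = 2 ∧ σ 2 = 1) := by
  revert σ
  decide

/-- The compact-adjacent partner `[2,0,1] = {θ₂<θ₀<θ₁}` of `S⁺` as a permutation: `swap 0 1 * swap 0 2`. [cite: Rogawski1990, §8.4 p. 126] -/
theorem perm_201_apply : (Equiv.swap (0 : Fin 3) 1 * Equiv.swap (0 : Fin 3) 2) 0 = 2 ∧ (Equiv.swap (0 : Fin 3) 1 * Equiv.swap (0 : Fin 3) 2) 1 = 0 ∧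
    (Equiv.swap (0 : Fin 3) 1 * Equiv.swap (0 : Fin 3) 2) 2 = 1 := by
  decide

/-- The compact-adjacent partner `[1,0,2] = {θ₁<θ₀<θ₂}` of `S⁻` as a permutation: `swap 0 1`. [cite: Rogawski1990, §8.4 p. 126] -/
theorem perm_102_apply : (Equiv.swap (0 : Fin 3) 1) 0 = 1 ∧ (Equiv.swap (0 : Fin 3) 1) 1 = 0 ∧ (Equiv.swap (0 : Fin 3) 1) 2 = 2 := by
  decide

/-- Near the corner every NONZERO wall parameter is semiregular: `0 < |t| < 2π∕3 ⇒ cos 3t ≠ 1`. [cite: Rogawski1990, §8.2 p. 119] -/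
theorem cos_three_mul_ne_one_of_abs_lt {t : ℝ} (ht : t ≠ 0) (hlt : |t| < 2 * Real.pi / 3) : Real.cos (3 * t) ≠ 1 := by
  intro h
  obtain ⟨n, hn⟩ := (Real.cos_eq_one_iff (3 * t)).1 h
  have habs : |(n : ℝ)| * (2 * Real.pi) = |3 * t| := by
    rw [← hn, abs_mul, abs_of_pos Real.two_pi_pos]
  have h3 : |3 * t| < 2 * Real.pi := by
    rw [abs_mul, abs_of_pos (by norm_num : (0 : ℝ) < 3)]
    linarith
  have hn1 : |(n : ℝ)| < 1 := lt_of_mul_lt_mul_right (by rw [one_mul, habs]; exact h3) Real.two_pi_pos.le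
  have hn0 : n = 0 := Int.abs_lt_one_iff.mp (by exact_mod_cast hn1)
  rw [hn0, Int.cast_zero, zero_mul] at hn
  exact ht (by linarith)

/-- The wall parameters `t ∈ (0, δ)` ∕ `(−δ, 0)` with `δ ≤ 2π∕3` are semiregular. [cite: Rogawski1990, §8.2 p. 119] -/
theorem cos_three_mul_ne_one_of_mem_Ioo {δ t : ℝ} (hδ : δ ≤ 2 * Real.pi / 3) (ht : t ∈ Ioo (-δ) δ) (ht0 : t ≠ 0) : Real.cos (3 * t) ≠ 1 :=
  cos_three_mul_ne_one_of_abs_lt ht0 (lt_of_lt_of_le (abs_lt.2 ht) hδ)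

end Prelim

/-! ## §2 The assembly -/

section Assembly

variable {L : Type} [Field L] [NumberField L] [IsCMField L] {α : Fin 3 → L} {w : {w : InfinitePlace L // IsComplex w}}

/-- **N1 FROM {(A6) CORNER REGULARITY, THE D-CHAMBER WALL VALUE, THE (J3-odd)₃ CUBE LIMITS}** (CM ground field; the frame's pair `{0,2}` noncompact: `re σ_wα₀ · re σ_wα₂ < 0`).
`hreg` = the (A6) row ★ `ArchCentralLimitCornerRegularity`; `hD` = ★ `of_cornerRegularity`'s `hval` restricted to the four chambers adjacent to the compact wall `θ₀ = θ₁` (`σ 0 = 2 ∨ σ 2 = 2`;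
ROAD A's (A3)∕(A4) wall value, F0P3a-p06 W6); `hS` = (J3-odd)₃ in the shape of ★ p843408's `hJ3` at every semiregular point of the noncompact wall `θ₀ = θ₂` (A-p18 road Z, Z5).  THEN
`ArchCentralLimitFormulaRankTwo L α w`.  The two doubly-noncompact chambers inherit the value across `θ₀ = θ₂` (★ (h4) + ★ (J3-odd)₁ CM + ★ (J3-odd)₃ decoupling).
[cite: Rogawski1990, §8.4 pp. 126–127] [cite: Varadarajan1989, §6.4 Thm 22] [cite: HarishChandra1975HARRG1, §17 Lemma 17.5] -/
theorem ArchCentralLimitFormulaRankTwo.of_cornerRegularity_of_wallValues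
    (h02 : (w.1.embedding (α 0)).re * (w.1.embedding (α 2)).re < 0)
    (hreg : ArchCentralLimitCornerRegularity L α w)
    (hD : ∀ [MeasurableSpace (archLocal L 3 (Matrix.diagonal α) w)] [BorelSpace (archLocal L 3 (Matrix.diagonal α) w)],
      (∀ i, α i ≠ 0) → (∀ i, (w.1.embedding (α i)).im = 0) →
      (∃ i j : Fin 3, (w.1.embedding (α i)).re * (w.1.embedding (α j)).re < 0) →
      ∀ (ν : Measure (archLocal L 3 (Matrix.diagonal α) w)) [ν.IsHaarMeasure] [ν.IsMulRightInvariant],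
      ∃ c : ℝ, 0 < c ∧
        ∀ (Θ : Matrix (Fin 3) (Fin 3) ℂ → ℂ), ContDiff ℝ (⊤ : ℕ∞) Θ →
          HasCompactSupport (fun k : archLocal L 3 (Matrix.diagonal α) w => Θ ((k : GL (Fin 3) ℂ) : Matrix (Fin 3) (Fin 3) ℂ)) →
          ∀ (ζ : Circle) (σ : Equiv.Perm (Fin 3)), (σ 0 = 2 ∨ σ 2 = 2) →
            ∀ (U : Set (Fin 3 → ℝ)) (H : (Fin 3 → ℝ) → ℂ), IsOpen U → (0 : Fin 3 → ℝ) ∈ U → ContDiffOn ℝ 3 H U →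
            (∀ θ ∈ U, θ (σ 0) < θ (σ 1) ∧ θ (σ 1) < θ (σ 2) →
              H θ = ((((ζ * Circle.exp (θ 0) : Circle) : ℂ)) * (((ζ * Circle.exp (θ 2) : Circle) : ℂ))⁻¹) * ((1 - (((ζ * Circle.exp (θ 1) : Circle) : ℂ)) * (((ζ * Circle.exp (θ 0) : Circle) : ℂ))⁻¹) * (1 - (((ζ * Circle.exp (θ 2) : Circle) : ℂ)) * (((ζ * Circle.exp (θ 1) : Circle) : ℂ))⁻¹) * (1 - (((ζ * Circle.exp (θ 2) : Circle) : ℂ)) * (((ζ * Circle.exp (θ 0) : Circle) : ℂ))⁻¹)) * (∫ g, Θ (((g * ⟨circleDiagonal 3 (fun k => ζ * Circle.exp (θ k)), circleDiagonal_mem_archLocal_diagonal L 3 α w _⟩ * g⁻¹ : archLocal L 3 (Matrix.diagonal α) w) : GL (Fin 3) ℂ) : Matrix (Fin 3) (Fin 3) ℂ) ∂ν)) →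
            (1 / 48 : ℂ) * ∑ ε : Fin 3 → Bool, ((((if ε 0 then (1 : ℝ) else -1) * (if ε 1 then (1 : ℝ) else -1) * (if ε 2 then (1 : ℝ) else -1) : ℝ)) : ℂ) *
          iteratedDeriv 3 (fun s : ℝ => H (s • ![(if ε 0 then (1 : ℝ) else -1) + (if ε 1 then (1 : ℝ) else -1), -(if ε 0 then (1 : ℝ) else -1) + (if ε 2 then (1 : ℝ) else -1), -(if ε 1 then (1 : ℝ) else -1) - (if ε 2 then (1 : ℝ) else -1)])) 0 =
                -((c : ℂ) * Complex.I) * Θ ((circleDiagonal 3 (fun _ => ζ) : GL (Fin 3) ℂ) : Matrix (Fin 3) (Fin 3) ℂ))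
    (hS : ∀ [MeasurableSpace (archLocal L 3 (Matrix.diagonal α) w)] [BorelSpace (archLocal L 3 (Matrix.diagonal α) w)],
      (∀ i, α i ≠ 0) → (∀ i, (w.1.embedding (α i)).im = 0) →
      ∀ (ν : Measure (archLocal L 3 (Matrix.diagonal α) w)) [ν.IsHaarMeasure] [ν.IsMulRightInvariant]
        (Θ : Matrix (Fin 3) (Fin 3) ℂ → ℂ), ContDiff ℝ (⊤ : ℕ∞) Θ →
          HasCompactSupport (fun k : archLocal L 3 (Matrix.diagonal α) w => Θ ((k : GL (Fin 3) ℂ) : Matrix (Fin 3) (Fin 3) ℂ)) →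
          ∀ (ζ : Circle) (t : ℝ), Real.cos (3 * t) ≠ 1 →
            ∃ Lim : ℂ, Tendsto (fun ψ : ℝ => iteratedDeriv 3 (fun s : ℝ =>
              ((((ζ * Circle.exp ((t • (![1, -2, 1] : Fin 3 → ℝ) + s • (![1, 0, -1] : Fin 3 → ℝ)) 0) : Circle) : ℂ)) * (((ζ * Circle.exp ((t • (![1, -2, 1] : Fin 3 → ℝ) + s • (![1, 0, -1] : Fin 3 → ℝ)) 2) : Circle) : ℂ))⁻¹) * ((1 - (((ζ * Circle.exp ((t • (![1, -2, 1] : Fin 3 → ℝ) + s • (![1, 0, -1] : Fin 3 → ℝ)) 1) : Circle) : ℂ)) * (((ζ * Circle.exp ((t • (![1, -2, 1] : Fin 3 → ℝ) + s • (![1, 0, -1] : Fin 3 → ℝ)) 0) : Circle) : ℂ))⁻¹) * (1 - (((ζ * Circle.exp ((t • (![1, -2, 1] : Fin 3 → ℝ) + s • (![1, 0, -1] : Fin 3 → ℝ)) 2) : Circle) : ℂ)) * (((ζ * Circle.exp ((t • (![1, -2, 1] : Fin 3 → ℝ) + s • (![1, 0, -1] : Fin 3 → ℝ)) 1) : Circle)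 : ℂ))⁻¹) * (1 - (((ζ * Circle.exp ((t • (![1, -2, 1] : Fin 3 → ℝ) + s • (![1, 0, -1] : Fin 3 → ℝ)) 2) : Circle) : ℂ)) * (((ζ * Circle.exp ((t • (![1, -2, 1] : Fin 3 → ℝ) + s • (![1, 0, -1] : Fin 3 → ℝ)) 0) : Circle) : ℂ))⁻¹)) * (∫ g, Θ (((g * ⟨circleDiagonal 3 (fun k => ζ * Circle.exp ((t • (![1, -2, 1] : Fin 3 → ℝ) + s • (![1, 0, -1] : Fin 3 → ℝ)) k)), circleDiagonal_mem_archLocal_diagonal L 3 α w _⟩ * g⁻¹ : archLocal L 3 (Matrix.diagonal α) w) : GL (Fin 3) ℂ) : Matrix (Fin 3) (Fin 3) ℂ) ∂ν)) ψ) (𝓝[≠] 0) (𝓝 Lim)) :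
    ArchCentralLimitFormulaRankTwo L α w := by
  refine ArchCentralLimitFormulaRankTwo.of_cornerRegularity hreg ?_
  intro _ _ hα hreal hind ν _ _
  haveI : LocallyCompactSpace (archLocal L 3 (Matrix.diagonal α) w) := locallyCompactSpace_archLocal L 3 (Matrix.diagonal α) w
  haveI : SecondCountableTopology (archLocal L 3 (Matrix.diagonal α) w) := secondCountableTopology_archLocal L 3 (Matrix.diagonal α) w
  obtain ⟨c, hc, hDv⟩ := hD hα hreal hind ν
  refine ⟨c, hc, fun Θ hΘ hΘc ζ σ U H hUo h0U hH hHF => ?_⟩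
  rcases perm_fin_three_cases σ with hσ | hσ | ⟨hσ0, hσ1, hσ2⟩ | ⟨hσ0, hσ1, hσ2⟩
  · exact hDv Θ hΘ hΘc ζ σ (Or.inl hσ) U H hUo h0U hH hHF
  · exact hDv Θ hΘ hΘc ζ σ (Or.inr hσ) U H hUo h0U hH hHF
  · /- `S⁻ = {θ₁<θ₂<θ₀}` (`σ = [1,2,0]`): partner `D⁺ ∋ {θ₁<θ₀<θ₂}` (`swap 0 1`) across the half-wall `t ∈ (0, δ)`; the given `H` is the `s > 0` side -/
    have hHFc : ∀ θ ∈ U, θ 1 < θ 2 ∧ θ 2 < θ 0 → H θ = ((((ζ * Circle.exp (θ 0) : Circle) : ℂ)) * (((ζ * Circle.exp (θ 2) : Circle) : ℂ))⁻¹) * ((1 - (((ζ * Circle.exp (θ 1) : Circle) : ℂ)) * (((ζ * Circle.exp (θ 0) : Circle) : ℂ))⁻¹) * (1 - (((ζ * Circle.exp (θ 2) : Circle) : ℂ)) * (((ζ * Circle.exp (θ 1) : Circle) : ℂ))⁻¹) * (1 - (((ζ * Circle.exp (θ 2) : Circle) : ℂ)) * (((ζ * Circle.exp (θ 0) : Circle)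 : ℂ))⁻¹)) * (∫ g, Θ (((g * ⟨circleDiagonal 3 (fun k => ζ * Circle.exp (θ k)), circleDiagonal_mem_archLocal_diagonal L 3 α w _⟩ * g⁻¹ : archLocal L 3 (Matrix.diagonal α) w) : GL (Fin 3) ℂ) : Matrix (Fin 3) (Fin 3) ℂ) ∂ν) := by
      intro θ hθ hp
      exact hHF θ hθ (by rw [hσ0, hσ1, hσ2]; exact hp)
    obtain ⟨U', H', hU'o, h0U', hH', hH'F⟩ := hreg hα hreal ν Θ hΘ hΘc ζ (Equiv.swap (0 : Fin 3) 1)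
    obtain ⟨e0, e1, e2⟩ := perm_102_apply
    have hH'Fc : ∀ θ ∈ U', θ 1 < θ 0 ∧ θ 0 < θ 2 → H' θ = ((((ζ * Circle.exp (θ 0) : Circle) : ℂ)) * (((ζ * Circle.exp (θ 2) : Circle) : ℂ))⁻¹) * ((1 - (((ζ * Circle.exp (θ 1) : Circle) : ℂ)) * (((ζ * Circle.exp (θ 0) : Circle) : ℂ))⁻¹) * (1 - (((ζ * Circle.exp (θ 2) : Circle) : ℂ)) * (((ζ * Circle.exp (θ 1) : Circle) : ℂ))⁻¹) * (1 - (((ζ * Circle.exp (θ 2) : Circle) : ℂ)) * (((ζ * Circle.exp (θ 0) : Circle) : ℂ))⁻¹)) * (∫ g, Θ (((g * ⟨circleDiagonal 3 (fun k => ζ * Circle.exp (θ k)), circleDiagonal_mem_archLocal_diagonal L 3 α w _⟩ * g⁻¹ : archLocal L 3 (Matrix.diagonal α) w) : GL (Fin 3) ℂ) : Matrix (Fin 3) (Fin 3) ℂ) ∂ν) := by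
      intro θ hθ hp
      exact hH'F θ hθ (by rw [e0, e1, e2]; exact hp)
    -- the common open set and the admissible wall parameters
    have hU''o : IsOpen (U ∩ U') := hUo.inter hU'o
    have h0'' : (0 : Fin 3 → ℝ) ∈ U ∩ U' := ⟨h0U, h0U'⟩
    have hH3 : ContDiffOn ℝ 3 H (U ∩ U') := hH.mono inter_subset_left
    have hH'3 : ContDiffOn ℝ 3 H' (U ∩ U') := hH'.mono inter_subset_right
    have hpre : IsOpen ((fun t : ℝ => t • (![1, -2, 1] : Fin 3 → ℝ)) ⁻¹' (U ∩ U')) := hU''o.preimage (by fun_prop)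
    have h0pre : (0 : ℝ) ∈ (fun t : ℝ => t • (![1, -2, 1] : Fin 3 → ℝ)) ⁻¹' (U ∩ U') := by
      simpa only [mem_preimage, zero_smul] using h0''
    obtain ⟨ε, hε, hball⟩ := Metric.isOpen_iff.1 hpre 0 h0pre
    obtain ⟨δ, hδdef⟩ : ∃ δ : ℝ, δ = min ε (2 * Real.pi / 3) := ⟨_, rfl⟩
    have hδ : 0 < δ := by rw [hδdef]; exact lt_min hε (by positivity)
    have hδU : ∀ t : ℝ, |t| < δ → t • (![1, -2, 1] : Fin 3 → ℝ) ∈ U ∩ U' := fun t ht =>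
      hball (by rw [Metric.mem_ball, dist_zero_right, Real.norm_eq_abs]; exact lt_of_lt_of_le ht (hδdef ▸ min_le_left _ _))
    have hδπ : δ ≤ 2 * Real.pi / 3 := hδdef ▸ min_le_right _ _
    have hSU : ∀ t ∈ Ioo (0 : ℝ) δ, t • (![1, -2, 1] : Fin 3 → ℝ) ∈ U ∩ U' := fun t ht => hδU t (by rw [abs_of_pos ht.1]; exact ht.2)
    have hSreg : ∀ t ∈ Ioo (0 : ℝ) δ, Real.cos (3 * t) ≠ 1 := fun t ht =>
      cos_three_mul_ne_one_of_mem_Ioo hδπ ⟨by linarith [ht.1, ht.2], ht.2⟩ ht.1.ne'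
    -- side agreements along the normal lines through the wall points `tA′`, `t ∈ (0, δ)`
    have hline : ∀ t : ℝ, Continuous (fun s : ℝ => t • (![1, -2, 1] : Fin 3 → ℝ) + s • (![1, 0, -1] : Fin 3 → ℝ)) := fun t => by fun_prop
    have hmem : ∀ t ∈ Ioo (0 : ℝ) δ, ∀ᶠ s in 𝓝 (0 : ℝ), t • (![1, -2, 1] : Fin 3 → ℝ) + s • (![1, 0, -1] : Fin 3 → ℝ) ∈ U ∩ U' := fun t ht =>
      (hline t).continuousAt.preimage_mem_nhds (hU''o.mem_nhds (by simpa only [zero_smul, add_zero] using hSU t ht))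
    have hside : ∀ t ∈ Ioo (0 : ℝ) δ, ∀ᶠ s in 𝓝[>] (0 : ℝ), H (t • (![1, -2, 1] : Fin 3 → ℝ) + s • (![1, 0, -1] : Fin 3 → ℝ)) =
        ((((ζ * Circle.exp ((t • (![1, -2, 1] : Fin 3 → ℝ) + s • (![1, 0, -1] : Fin 3 → ℝ)) 0) : Circle) : ℂ)) * (((ζ * Circle.exp ((t • (![1, -2, 1] : Fin 3 → ℝ) + s • (![1, 0, -1] : Fin 3 → ℝ)) 2) : Circle) : ℂ))⁻¹) * ((1 - (((ζ * Circle.exp ((t • (![1, -2, 1] : Fin 3 → ℝ) + s • (![1, 0, -1] : Fin 3 → ℝ)) 1) : Circle) : ℂ)) * (((ζ * Circle.exp ((t • (![1, -2, 1] : Fin 3 → ℝ) + s • (![1, 0, -1] : Fin 3 → ℝ)) 0) : Circle) : ℂ))⁻¹) * (1 - (((ζ * Circle.exp ((t • (![1, -2, 1] : Fin 3 → ℝ) + s • (![1, 0, -1] : Fin 3 → ℝ)) 2) : Circle) : ℂ)) * (((ζ * Circle.exp ((t • (![1, -2, 1] : Fin 3 → ℝ) + s • (![1, 0, -1] : Fin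 3 → ℝ)) 1) : Circle) : ℂ))⁻¹) * (1 - (((ζ * Circle.exp ((t • (![1, -2, 1] : Fin 3 → ℝ) + s • (![1, 0, -1] : Fin 3 → ℝ)) 2) : Circle) : ℂ)) * (((ζ * Circle.exp ((t • (![1, -2, 1] : Fin 3 → ℝ) + s • (![1, 0, -1] : Fin 3 → ℝ)) 0) : Circle) : ℂ))⁻¹)) * (∫ g, Θ (((g * ⟨circleDiagonal 3 (fun k => ζ * Circle.exp ((t • (![1, -2, 1] : Fin 3 → ℝ) + s • (![1, 0, -1] : Fin 3 → ℝ)) k)), circleDiagonal_mem_archLocal_diagonal L 3 α w _⟩ * g⁻¹ : archLocal L 3 (Matrix.diagonal α) w) : GL (Fin 3) ℂ) : Matrix (Fin 3) (Fin 3) ℂ) ∂ν) := by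
      intro t ht
      filter_upwards [mem_nhdsWithin_of_mem_nhds (hmem t ht), Ioo_mem_nhdsGT (show (0 : ℝ) < 3 * t by linarith [ht.1])] with s hsU hs
      exact hHFc _ hsU.1 (wall02_line_mem_chamber_pos_pos hs.1 hs.2)
    have hside' : ∀ t ∈ Ioo (0 : ℝ) δ, ∀ᶠ s in 𝓝[<] (0 : ℝ), H' (t • (![1, -2, 1] : Fin 3 → ℝ) + s • (![1, 0, -1] : Fin 3 → ℝ)) =
        ((((ζ * Circle.exp ((t • (![1, -2, 1] : Fin 3 → ℝ) + s • (![1, 0, -1] : Fin 3 → ℝ)) 0) : Circle) : ℂ)) * (((ζ * Circle.exp ((t • (![1, -2, 1] : Fin 3 → ℝ) + s • (![1, 0, -1] : Fin 3 → ℝ)) 2) : Circle) : ℂ))⁻¹) * ((1 - (((ζ * Circle.exp ((t • (![1, -2, 1] : Fin 3 → ℝ) + s • (![1, 0, -1] : Fin 3 → ℝ)) 1) : Circle) : ℂ)) * (((ζ * Circle.exp ((t • (![1, -2, 1] : Fin 3 → ℝ) + s • (![1, 0, -1] : Fin 3 → ℝ)) 0) : Circle) : ℂ))⁻¹) * (1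 - (((ζ * Circle.exp ((t • (![1, -2, 1] : Fin 3 → ℝ) + s • (![1, 0, -1] : Fin 3 → ℝ)) 2) : Circle) : ℂ)) * (((ζ * Circle.exp ((t • (![1, -2, 1] : Fin 3 → ℝ) + s • (![1, 0, -1] : Fin 3 → ℝ)) 1) : Circle) : ℂ))⁻¹) * (1 - (((ζ * Circle.exp ((t • (![1, -2, 1] : Fin 3 → ℝ) + s • (![1, 0, -1] : Fin 3 → ℝ)) 2) : Circle) : ℂ)) * (((ζ * Circle.exp ((t • (![1, -2, 1] : Fin 3 → ℝ) + s • (![1, 0, -1] : Fin 3 → ℝ)) 0) : Circle) : ℂ))⁻¹)) * (∫ g, Θ (((g * ⟨circleDiagonal 3 (fun k => ζ * Circle.exp ((t • (![1, -2, 1] : Fin 3 → ℝ) + s • (![1, 0, -1] : Fin 3 → ℝ)) k)), circleDiagonal_mem_archLocal_diagonal L 3 α w _⟩ * g⁻¹ : archLocal L 3 (Matrix.diagonal α) w) : GL (Fin 3) ℂ) : Matrix (Fin 3) (Fin 3) ℂ) ∂ν) := by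
      intro t ht
      filter_upwards [mem_nhdsWithin_of_mem_nhds (hmem t ht), Ioo_mem_nhdsLT (show -(3 * t) < (0 : ℝ) by linarith [ht.1])] with s hsU hs
      exact hH'Fc _ hsU.2 (wall02_line_mem_chamber_pos_neg hs.2 hs.1)
    -- (h1): first normal derivatives agree ((J-nc), CM)
    have h1 := deriv_cornerExtensions_eq_of_wall02 L α w hα hreal h02 ν Θ hΘ hΘc ζ hU''o (hH3.of_le (by norm_num)) (hH'3.of_le (by norm_num))
      hSU hSreg hside hside'
    -- (h3): normal cubes agree, from `hS`
    have key3 := iteratedDeriv_three_cornerExtensions_eq_of_wall02_cubeLimit (fun z : Fin 3 → Circle => ∫ g, Θ (((g * ⟨circleDiagonal 3 z, circleDiagonal_mem_archLocal_diagonal L 3 α w z⟩ * g⁻¹ : archLocal L 3 (Matrix.diagonal α) w) : GL (Fin 3) ℂ) : Matrix (Fin 3) (Fin 3) ℂ) ∂ν) ζ hU''o hH3 hH'3 hSU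
    beta_reduce at key3
    have h3 := key3 hside hside' (fun t ht => hS hα hreal ν Θ hΘ hΘc ζ t (hSreg t ht))
    -- (h4): the corner values agree; the partner's value is `hD`
    have hS0 : (0 : ℝ) ∈ closure (Ioo (0 : ℝ) δ) := by
      rw [closure_Ioo hδ.ne]; exact ⟨le_rfl, hδ.le⟩
    have h4 := lambda8Angle_zero_eq_of_wall02_oddJets_of_isOpen H H' hU''o h0'' hH3 hH'3 isOpen_Ioo hS0 h1 h3
    rw [h4]
    exact hDv Θ hΘ hΘc ζ (Equiv.swap (0 : Fin 3) 1) (Or.inr e2) (U ∩ U') H' hU''o h0'' hH'3 (fun θ hθ hp => hH'F θ hθ.2 hp)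
  · /- `S⁺ = {θ₀<θ₂<θ₁}` (`σ = [0,2,1]`): partner `D⁻ ∋ {θ₂<θ₀<θ₁}` (`swap 0 1 * swap 0 2`) across the half-wall `t ∈ (−δ, 0)`; the given `H` is the `s < 0` side -/
    have hHFc : ∀ θ ∈ U, θ 0 < θ 2 ∧ θ 2 < θ 1 → H θ = ((((ζ * Circle.exp (θ 0) : Circle) : ℂ)) * (((ζ * Circle.exp (θ 2) : Circle) : ℂ))⁻¹) * ((1 - (((ζ * Circle.exp (θ 1) : Circle) : ℂ)) * (((ζ * Circle.exp (θ 0) : Circle) : ℂ))⁻¹) * (1 - (((ζ * Circle.exp (θ 2) : Circle) : ℂ)) * (((ζ * Circle.exp (θ 1) : Circle) : ℂ))⁻¹) * (1 - (((ζ * Circle.exp (θ 2) : Circle) : ℂ)) * (((ζ * Circle.exp (θ 0) : Circle) : ℂ))⁻¹)) * (∫ g, Θ (((g * ⟨circleDiagonal 3 (fun k => ζ * Circle.exp (θ k)), circleDiagonal_mem_archLocal_diagonal L 3 α w _⟩ * g⁻¹ : archLocal L 3 (Matrix.diagonal α) w) : GL (Fin 3) ℂ) : Matrix (Fin 3) (Fin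 3) ℂ) ∂ν) := by
      intro θ hθ hp
      exact hHF θ hθ (by rw [hσ0, hσ1, hσ2]; exact hp)
    obtain ⟨U', H', hU'o, h0U', hH', hH'F⟩ := hreg hα hreal ν Θ hΘ hΘc ζ (Equiv.swap (0 : Fin 3) 1 * Equiv.swap (0 : Fin 3) 2)
    obtain ⟨e0, e1, e2⟩ := perm_201_apply
    have hH'Fc : ∀ θ ∈ U', θ 2 < θ 0 ∧ θ 0 < θ 1 → H' θ = ((((ζ * Circle.exp (θ 0) : Circle) : ℂ)) * (((ζ * Circle.exp (θ 2) : Circle) : ℂ))⁻¹) * ((1 - (((ζ * Circle.exp (θ 1) : Circle) : ℂ)) * (((ζ * Circle.exp (θ 0) : Circle) : ℂ))⁻¹) * (1 - (((ζ * Circle.exp (θ 2) : Circle) : ℂ)) * (((ζ * Circle.exp (θ 1) : Circle) : ℂ))⁻¹) * (1 - (((ζ * Circle.exp (θ 2) : Circle) : ℂ)) * (((ζ * Circle.exp (θ 0) : Circle) : ℂ))⁻¹)) * (∫ g, Θ (((g * ⟨circleDiagonal 3 (fun k => ζ * Circle.exp (θ k)), circleDiagonal_mem_archLocal_diagonal L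 3 α w _⟩ * g⁻¹ : archLocal L 3 (Matrix.diagonal α) w) : GL (Fin 3) ℂ) : Matrix (Fin 3) (Fin 3) ℂ) ∂ν) := by
      intro θ hθ hp
      exact hH'F θ hθ (by rw [e0, e1, e2]; exact hp)
    have hU''o : IsOpen (U ∩ U') := hUo.inter hU'o
    have h0'' : (0 : Fin 3 → ℝ) ∈ U ∩ U' := ⟨h0U, h0U'⟩
    have hH3 : ContDiffOn ℝ 3 H (U ∩ U') := hH.mono inter_subset_left
    have hH'3 : ContDiffOn ℝ 3 H' (U ∩ U') := hH'.mono inter_subset_right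
    have hpre : IsOpen ((fun t : ℝ => t • (![1, -2, 1] : Fin 3 → ℝ)) ⁻¹' (U ∩ U')) := hU''o.preimage (by fun_prop)
    have h0pre : (0 : ℝ) ∈ (fun t : ℝ => t • (![1, -2, 1] : Fin 3 → ℝ)) ⁻¹' (U ∩ U') := by
      simpa only [mem_preimage, zero_smul] using h0''
    obtain ⟨ε, hε, hball⟩ := Metric.isOpen_iff.1 hpre 0 h0pre
    obtain ⟨δ, hδdef⟩ : ∃ δ : ℝ, δ = min ε (2 * Real.pi / 3) := ⟨_, rfl⟩
    have hδ : 0 < δ := by rw [hδdef]; exact lt_min hε (by positivity)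
    have hδU : ∀ t : ℝ, |t| < δ → t • (![1, -2, 1] : Fin 3 → ℝ) ∈ U ∩ U' := fun t ht =>
      hball (by rw [Metric.mem_ball, dist_zero_right, Real.norm_eq_abs]; exact lt_of_lt_of_le ht (hδdef ▸ min_le_left _ _))
    have hδπ : δ ≤ 2 * Real.pi / 3 := hδdef ▸ min_le_right _ _
    have hSU : ∀ t ∈ Ioo (-δ) (0 : ℝ), t • (![1, -2, 1] : Fin 3 → ℝ) ∈ U ∩ U' := fun t ht => hδU t (by rw [abs_of_neg ht.2]; linarith [ht.1])
    have hSreg : ∀ t ∈ Ioo (-δ) (0 : ℝ), Real.cos (3 * t) ≠ 1 := fun t ht =>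
      cos_three_mul_ne_one_of_mem_Ioo hδπ ⟨ht.1, by linarith [ht.1, ht.2]⟩ ht.2.ne
    have hline : ∀ t : ℝ, Continuous (fun s : ℝ => t • (![1, -2, 1] : Fin 3 → ℝ) + s • (![1, 0, -1] : Fin 3 → ℝ)) := fun t => by fun_prop
    have hmem : ∀ t ∈ Ioo (-δ) (0 : ℝ), ∀ᶠ s in 𝓝 (0 : ℝ), t • (![1, -2, 1] : Fin 3 → ℝ) + s • (![1, 0, -1] : Fin 3 → ℝ) ∈ U ∩ U' := fun t ht =>
      (hline t).continuousAt.preimage_mem_nhds (hU''o.mem_nhds (by simpa only [zero_smul, add_zero] using hSU t ht))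
    -- along `t < 0` the `s > 0` side is the PARTNER `H′` and the `s < 0` side is the given `H`
    have hside : ∀ t ∈ Ioo (-δ) (0 : ℝ), ∀ᶠ s in 𝓝[>] (0 : ℝ), H' (t • (![1, -2, 1] : Fin 3 → ℝ) + s • (![1, 0, -1] : Fin 3 → ℝ)) =
        ((((ζ * Circle.exp ((t • (![1, -2, 1] : Fin 3 → ℝ) + s • (![1, 0, -1] : Fin 3 → ℝ)) 0) : Circle) : ℂ)) * (((ζ * Circle.exp ((t • (![1, -2, 1] : Fin 3 → ℝ) + s • (![1, 0, -1] : Fin 3 → ℝ)) 2) : Circle) : ℂ))⁻¹) * ((1 - (((ζ * Circle.exp ((t • (![1, -2, 1] : Fin 3 → ℝ) + s • (![1, 0, -1] : Fin 3 → ℝ)) 1) : Circle) : ℂ)) * (((ζ * Circle.exp ((t • (![1, -2, 1] : Fin 3 → ℝ) + s • (![1, 0, -1] : Fin 3 → ℝ)) 0) : Circle) : ℂ))⁻¹) * (1 - (((ζ * Circle.exp ((t • (![1, -2, 1] : Fin 3 → ℝ) + s • (![1, 0, -1] : Fin 3 → ℝ)) 2) : Circle) : ℂ)) * (((ζ * Circle.exp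 ((t • (![1, -2, 1] : Fin 3 → ℝ) + s • (![1, 0, -1] : Fin 3 → ℝ)) 1) : Circle) : ℂ))⁻¹) * (1 - (((ζ * Circle.exp ((t • (![1, -2, 1] : Fin 3 → ℝ) + s • (![1, 0, -1] : Fin 3 → ℝ)) 2) : Circle) : ℂ)) * (((ζ * Circle.exp ((t • (![1, -2, 1] : Fin 3 → ℝ) + s • (![1, 0, -1] : Fin 3 → ℝ)) 0) : Circle) : ℂ))⁻¹)) * (∫ g, Θ (((g * ⟨circleDiagonal 3 (fun k => ζ * Circle.exp ((t • (![1, -2, 1] : Fin 3 → ℝ) + s • (![1, 0, -1] : Fin 3 → ℝ)) k)), circleDiagonal_mem_archLocal_diagonal L 3 α w _⟩ * g⁻¹ : archLocal L 3 (Matrix.diagonal α) w) : GL (Fin 3) ℂ) : Matrix (Fin 3) (Fin 3) ℂ) ∂ν) := by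
      intro t ht
      filter_upwards [mem_nhdsWithin_of_mem_nhds (hmem t ht), Ioo_mem_nhdsGT (show (0 : ℝ) < -(3 * t) by linarith [ht.2])] with s hsU hs
      exact hH'Fc _ hsU.2 (wall02_line_mem_chamber_neg_pos hs.1 hs.2)
    have hside' : ∀ t ∈ Ioo (-δ) (0 : ℝ), ∀ᶠ s in 𝓝[<] (0 : ℝ), H (t • (![1, -2, 1] : Fin 3 → ℝ) + s • (![1, 0, -1] : Fin 3 → ℝ)) =
        ((((ζ * Circle.exp ((t • (![1, -2, 1] : Fin 3 → ℝ) + s • (![1, 0, -1] : Fin 3 → ℝ)) 0) : Circle) : ℂ)) * (((ζ * Circle.exp ((t • (![1, -2, 1] : Fin 3 → ℝ) + s • (![1, 0, -1] : Fin 3 → ℝ)) 2) : Circle) : ℂ))⁻¹) * ((1 - (((ζ * Circle.exp ((t • (![1, -2, 1] : Fin 3 → ℝ) + s • (![1, 0, -1] : Fin 3 → ℝ)) 1) : Circle) : ℂ)) * (((ζ * Circle.exp ((t • (![1, -2, 1] : Fin 3 → ℝ) + s • (![1, 0, -1] : Fin 3 → ℝ)) 0) : Circle) : ℂ))⁻¹)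 * (1 - (((ζ * Circle.exp ((t • (![1, -2, 1] : Fin 3 → ℝ) + s • (![1, 0, -1] : Fin 3 → ℝ)) 2) : Circle) : ℂ)) * (((ζ * Circle.exp ((t • (![1, -2, 1] : Fin 3 → ℝ) + s • (![1, 0, -1] : Fin 3 → ℝ)) 1) : Circle) : ℂ))⁻¹) * (1 - (((ζ * Circle.exp ((t • (![1, -2, 1] : Fin 3 → ℝ) + s • (![1, 0, -1] : Fin 3 → ℝ)) 2) : Circle) : ℂ)) * (((ζ * Circle.exp ((t • (![1, -2, 1] : Fin 3 → ℝ) + s • (![1, 0, -1] : Fin 3 → ℝ)) 0) : Circle) : ℂ))⁻¹)) * (∫ g, Θ (((g * ⟨circleDiagonal 3 (fun k => ζ * Circle.exp ((t • (![1, -2, 1] : Fin 3 → ℝ) + s • (![1, 0, -1] : Fin 3 → ℝ)) k)), circleDiagonal_mem_archLocal_diagonal L 3 α w _⟩ * g⁻¹ : archLocal L 3 (Matrix.diagonal α) w) : GL (Fin 3) ℂ) : Matrix (Fin 3) (Fin 3) ℂ) ∂ν) := by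
      intro t ht
      filter_upwards [mem_nhdsWithin_of_mem_nhds (hmem t ht), Ioo_mem_nhdsLT (show 3 * t < (0 : ℝ) by linarith [ht.2])] with s hsU hs
      exact hHFc _ hsU.1 (wall02_line_mem_chamber_neg_neg hs.2 hs.1)
    have h1 := deriv_cornerExtensions_eq_of_wall02 L α w hα hreal h02 ν Θ hΘ hΘc ζ hU''o (hH'3.of_le (by norm_num)) (hH3.of_le (by norm_num))
      hSU hSreg hside hside'
    have key3 := iteratedDeriv_three_cornerExtensions_eq_of_wall02_cubeLimit (fun z : Fin 3 → Circle => ∫ g, Θ (((g * ⟨circleDiagonal 3 z, circleDiagonal_mem_archLocal_diagonal L 3 α w z⟩ * g⁻¹ : archLocal L 3 (Matrix.diagonal α) w) : GL (Fin 3) ℂ) : Matrix (Fin 3) (Fin 3) ℂ) ∂ν) ζ hU''o hH'3 hH3 hSU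
    beta_reduce at key3
    have h3 := key3 hside hside' (fun t ht => hS hα hreal ν Θ hΘ hΘc ζ t (hSreg t ht))
    have hS0 : (0 : ℝ) ∈ closure (Ioo (-δ) (0 : ℝ)) := by
      rw [closure_Ioo (by linarith : (-δ : ℝ) ≠ 0)]; exact ⟨by linarith, le_rfl⟩
    have h4 := lambda8Angle_zero_eq_of_wall02_oddJets_of_isOpen H' H hU''o h0'' hH'3 hH3 isOpen_Ioo hS0 h1 h3
    rw [← h4]
    exact hDv Θ hΘ hΘc ζ (Equiv.swap (0 : Fin 3) 1 * Equiv.swap (0 : Fin 3) 2) (Or.inl e0) (U ∩ U') H' hU''o h0'' hH'3 (fun θ hθ hp => hH'F θ hθ.2 hp)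

end Assembly

end Literature.NumberTheory.Rogawski1990

end
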